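import Literature.Analysis.FluidPDE.AncientMildWeak
import Literature.Analysis.FluidPDE.KNSSRegularityGluing
import Literature.Analysis.FluidPDE.OseenMildWindowRepresentative
import Summits.NavierStokesRegularity.NavierStokesRegularity.Theorems.HardyPointSinkNoHardyTypeIAncientHardyDriftConstant

/-!
# Route HardyPointSink — crux `NoHardyTypeIAncient`, line `birth`: Oseen-mild window representatives

Stub `stub_hardyOseenWindow` of the registered skeleton of line `birth` for the crux
`Summit.NavierStokesRegularity.NavierStokesRegularity.Theses.HardyPointSink.NoHardyTypeIAncient`
(item stmt-NavierStokesRegularity-7980).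

Let `u` be a bounded ancient mild solution of Navier–Stokes (`ν = 1`) in the tree's duality form
(`IsBoundedAncientMildSolution 1 u`), with a.e.-strongly measurable slices, jointly a.e.-strongly
measurable on the slab `(−∞, 0) × ℝ³`, and Hardy-bounded about every centre at a.e. time,
`∫ |u(t, x)|² / |x − x₀| dx ≤ K`. Then on every window `(a, b) ⊂ (−∞, 0)` the field `u` has a
representative `U` (`u(t) = U(t)` a.e. in space for a.e. `t ∈ (a, b)`) which is jointly continuous,
bounded, weakly divergence free at EVERY time of the window, and solves the Oseen integral equation
`U(t) = e^{(t−s)Δ}U(s) − B¹ₛ(U, U)(t)` pointwise for all `a < s < t < b` (the bounded mild class of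
Koch–Nadirashvili–Seregin–Šverák 2009, §4 (i)).

Proof (KNSS 2009, Lemma 3.1, §4 and the mildness clause of Thm 6.1, with the Hardy bound in place
of pointwise decay; all ingredients are tree theorems):

1. `u` is a bounded weak solution on `(−∞, 0)` (`IsBoundedAncientMildSolution.isBoundedWeakNSSolutionOn`),
   hence on `(a, b)` (`IsBoundedWeakNSSolutionOn.mono`), and its time translate `u(· + a)` is one on
   `(0, b − a)` (`IsBoundedWeakNSSolutionOn.comp_add_right`);
2. KNSS's Lemma 3.1 (`KNSS2009_weak_driftMild_holds`) writes `u(· + a) = U + b(t)` a.e. with `(U, b)`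
   drift-mild;
3. the Hardy bound about the origin gives the Morrey bound `∫_{B_n(0)} |u(t)|² ≤ K n` at a.e. time
   (`setLIntegral_ball_sq_le_of_hardy`), which kills the parasitic drift: `u(· + a) = V` a.e. with `V`
   drift-mild with ZERO drift (`IsKNSSDriftMild.exists_zeroDrift_of_morrey`);
4. zero-drift drift-mild fields are jointly continuous (`IsKNSSDriftMild.continuousOn_uncurry`),
   bounded, weakly divergence free at every time (`IsKNSSDriftMild.isWeaklyDivFree_of_mem`) and solve
   the Oseen equation (`IsKNSSDriftMild.eq_heatExtension_sub_oseenDuhamel_three`);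
5. translate back in time (`oseenDuhamel_comp_sub_right`).

The first hypothesis of the registered signature (the drift-constancy principle of the neighbouring
stub `stub_hardyDriftConstant`) is therefore not used: step 3 is its Morrey form, already a tree
theorem. [folklore]
-/

open MeasureTheory Set Function Filter TopologicalSpace
open scoped ENNReal NNReal Topology RealInnerProductSpace

set_option linter.dupNamespace false -- nested layout Summit.<S>.<Sub>, Sub = S (D-0017)

namespace Summit.NavierStokesRegularity.NavierStokesRegularity.Theorems

open Literature.Analysis.FluidPDE in
/-- **Stub `stub_hardyOseenWindow` (class bridge on windows).** Given the drift-constancy principle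
(unused: its Morrey form `IsKNSSDriftMild.exists_zeroDrift_of_morrey` is a tree theorem), a
Hardy-bounded duality-form bounded ancient mild solution with measurable slices, jointly
a.e.-strongly measurable on the slab, has on every window `(a, b) ⊂ (−∞, 0)` a continuous bounded
representative with weakly divergence-free slices solving the Oseen integral equation
`U(t) = e^{(t−s)Δ}U(s) − B¹ₛ(U, U)(t)` for all `a < s < t < b`: it is a bounded weak solution
(`IsBoundedAncientMildSolution.isBoundedWeakNSSolutionOn`); after restriction and time translation
KNSS's Lemma 3.1 (`KNSS2009_weak_driftMild_holds`) gives a drift-mild pair `(U, b)`; the Hardy bound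
about the origin gives the Morrey bound (`setLIntegral_ball_sq_le_of_hardy`), which makes the drift
constant and absorbable (`IsKNSSDriftMild.exists_zeroDrift_of_morrey`); zero-drift drift-mild fields
are continuous, weakly divergence free at every time and Oseen-mild. (KNSS 2009, Lemma 3.1, §4 (i)
and proof of Thm 6.1, last paragraph, arXiv:0709.3599 pp. 7–8, 12.) [folklore] -/
theorem stub_hardyOseenWindow :
    (∀ (T N : ℝ) (K : ℝ≥0)
      (u U : ℝ → EuclideanSpace ℝ (Fin 3) → EuclideanSpace ℝ (Fin 3))
      (b : ℝ → EuclideanSpace ℝ (Fin 3)),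
      0 < T →
      Literature.Analysis.FluidPDE.IsKNSSDriftMild T N U b →
      (∀ᵐ t ∂(volume.restrict (Ioo (0 : ℝ) T)), u t =ᵐ[volume] fun x => U t x + b t) →
      (∀ x₀ : EuclideanSpace ℝ (Fin 3), ∀ᵐ t ∂(volume.restrict (Ioo (0 : ℝ) T)),
        ∫⁻ x, ‖u t x‖ₑ ^ 2 / ‖x - x₀‖ₑ ≤ K) →
      ∃ β : EuclideanSpace ℝ (Fin 3), ∀ᵐ t ∂(volume.restrict (Ioo (0 : ℝ) T)), b t = β) →
    ∀ (u : ℝ → EuclideanSpace ℝ (Fin 3) → EuclideanSpace ℝ (Fin 3)),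
      (∀ t < 0, AEStronglyMeasurable (u t) volume) →
      AEStronglyMeasurable (uncurry u)
        (volume.restrict (Iio (0 : ℝ) ×ˢ (univ : Set (EuclideanSpace ℝ (Fin 3))))) →
      Literature.Analysis.FluidPDE.IsBoundedAncientMildSolution 1 u →
      (∃ K : ℝ≥0, ∀ x₀ : EuclideanSpace ℝ (Fin 3), ∀ᵐ t ∂(volume.restrict (Iio (0 : ℝ))),
        ∫⁻ x, ‖u t x‖ₑ ^ 2 / ‖x - x₀‖ₑ ≤ K) →
      ∀ a b : ℝ, a < b → b < 0 →
        ∃ U : ℝ → EuclideanSpace ℝ (Fin 3) → EuclideanSpace ℝ (Fin 3),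
          ContinuousOn (uncurry U) (Ioo a b ×ˢ (univ : Set (EuclideanSpace ℝ (Fin 3)))) ∧
          (∃ C : ℝ, ∀ t ∈ Ioo a b, ∀ x, ‖U t x‖ ≤ C) ∧
          (∀ t ∈ Ioo a b, Literature.Analysis.FluidPDE.IsWeaklyDivFree (U t)) ∧
          (∀ s t : ℝ, a < s → s < t → t < b → ∀ x,
            U t x = Literature.Analysis.UnboundedOperators.heatExtension (U s) (t - s) x -
              Literature.Analysis.FluidPDE.oseenDuhamel 1 s U U t x) ∧
          (∀ᵐ t ∂(volume.restrict (Ioo a b)), u t =ᵐ[volume] U t) := by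
  intro _ u hmeas hjoint hu hK a b hab hb0
  obtain ⟨K, hK⟩ := hK
  set T : ℝ := b - a with hT
  have hT0 : 0 < T := sub_pos.2 hab
  have hwin : ∀ {τ : ℝ}, τ ∈ Ioo 0 T → τ + a ∈ Ioo a b := fun hτ =>
    ⟨by linarith [hτ.1], by rw [hT] at hτ; linarith [hτ.2]⟩
  -- ## Step 1: `u` is a bounded weak solution on `(a, b)`; translate to `(0, T)`
  have hbw0 : IsBoundedWeakNSSolutionOn (Iio 0) isOpen_Iio 1 u :=
    hu.isBoundedWeakNSSolutionOn one_pos hjoint hmeas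
  have hbw1 : IsBoundedWeakNSSolutionOn (Ioo a b) isOpen_Ioo 1 u :=
    hbw0.mono isOpen_Ioo fun t ht => ht.2.trans hb0
  set ua : ℝ → EuclideanSpace ℝ (Fin 3) → EuclideanSpace ℝ (Fin 3) := fun s => u (s + a) with hua
  have hbw : IsBoundedWeakNSSolutionOn (Ioo 0 T) isOpen_Ioo 1 ua :=
    hbw1.comp_add_right a isOpen_Ioo fun t =>
      ⟨hwin, fun ht => ⟨by linarith [ht.1], by rw [hT]; linarith [ht.2]⟩⟩
  obtain ⟨M, hM⟩ := hu.2
  have hMa : ∀ s ∈ Ioo 0 T, ∀ y, ‖ua s y‖ ≤ M := fun s hs y =>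
    hM (s + a) ((hwin hs).2.trans hb0) y
  -- ## Step 2: Lemma 3.1
  obtain ⟨N, hN⟩ := KNSS2009_weak_driftMild_holds M T hT0
  obtain ⟨U, bd, hUb, hae⟩ := hN hbw hMa
  -- ## Step 3: Hardy about the origin ⟹ Morrey at a.e. time ⟹ zero drift
  have hH0 : ∀ᵐ τ ∂(volume.restrict (Ioo 0 T)), ∫⁻ x, ‖ua τ x‖ₑ ^ 2 / ‖x‖ₑ ≤ K := by
    have h1 := (ae_restrict_iff' (measurableSet_Iio (a := (0 : ℝ)))).1 (hK 0)
    have h2 := (measurePreserving_add_right (volume : Measure ℝ) a).quasiMeasurePreserving.ae h1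
    refine (ae_restrict_iff' measurableSet_Ioo).2 (h2.mono fun τ hτ hτI => ?_)
    simpa only [sub_zero] using hτ ((hwin hτI).2.trans hb0)
  have hMor : ∀ᵐ τ ∂(volume.restrict (Ioo 0 T)), ∀ m : ℕ, 1 ≤ m →
      ∫⁻ y in Metric.ball (0 : EuclideanSpace ℝ (Fin 3)) m, ‖U τ y + bd τ‖ₑ ^ 2 ≤
        ENNReal.ofReal ((K : ℝ) * m) := by
    filter_upwards [hae, hH0] with τ hτae hHτ m _
    have e : ∫⁻ y in Metric.ball (0 : EuclideanSpace ℝ (Fin 3)) m, ‖U τ y + bd τ‖ₑ ^ 2 =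
        ∫⁻ y in Metric.ball (0 : EuclideanSpace ℝ (Fin 3)) m, ‖ua τ y‖ₑ ^ 2 :=
      lintegral_congr_ae (ae_restrict_of_ae (hτae.mono fun y hy => by
        show ‖U τ y + bd τ‖ₑ ^ 2 = ‖ua τ y‖ₑ ^ 2
        rw [hy]))
    rw [e]
    exact setLIntegral_ball_sq_le_of_hardy hHτ
  obtain ⟨V, hV, hVae⟩ := hUb.exists_zeroDrift_of_morrey K.coe_nonneg hMor
  -- `ua(τ) = V(τ)` a.e. in space for a.e. `τ`
  have hslice : ∀ᵐ τ ∂(volume.restrict (Ioo 0 T)), ua τ =ᵐ[volume] V τ := by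
    filter_upwards [hae, hVae] with τ h1 h2
    exact h1.mono fun y hy => by
      show ua τ y = V τ y
      rw [hy]
      exact h2 y
  -- ## Steps 4–5: the representative in the original time variable
  refine ⟨fun t x => V (t - a) x, ?_, ?_, ?_, ?_, ?_⟩
  · -- joint continuity
    refine hV.continuousOn_uncurry.comp (f := fun q : ℝ × EuclideanSpace ℝ (Fin 3) => (q.1 - a, q.2))
      ((continuous_fst.sub continuous_const).prodMk continuous_snd).continuousOn ?_
    intro q hq
    exact ⟨⟨sub_pos.2 hq.1.1, by rw [hT]; linarith [hq.1.2]⟩, mem_univ _⟩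
  · -- the bound
    exact ⟨N + N, fun t ht x => hV.norm_le (t - a) ⟨sub_pos.2 ht.1, by rw [hT]; linarith [ht.2]⟩ x⟩
  · -- weakly divergence-free slices at every time
    intro t ht
    exact hV.isWeaklyDivFree_of_mem ⟨sub_pos.2 ht.1, by rw [hT]; linarith [ht.2]⟩
  · -- the Oseen identity
    intro s t has hst htb x
    have h1 := (hV.eq_heatExtension_sub_oseenDuhamel_three (s := s - a) (t := t - a)
      (sub_pos.2 has) (by linarith) (by rw [hT]; linarith)).1 x
    rw [show t - a - (s - a) = t - s by ring] at h1
    show V (t - a) x = Literature.Analysis.UnboundedOperators.heatExtension (V (s - a)) (t - s) x -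
      oseenDuhamel 1 s (fun τ => V (τ - a)) (fun τ => V (τ - a)) t x
    rw [oseenDuhamel_comp_sub_right]
    exact h1
  · -- `u(t) = V(t − a)` a.e. in space for a.e. `t ∈ (a, b)`: transport `hslice` by `t ↦ t − a`
    have h1 := (ae_restrict_iff' (measurableSet_Ioo (a := (0 : ℝ)) (b := T))).1 hslice
    have h2 := (measurePreserving_sub_right (volume : Measure ℝ) a).quasiMeasurePreserving.ae h1
    refine (ae_restrict_iff' measurableSet_Ioo).2 (h2.mono fun t ht htI => ?_)
    have h3 := ht ⟨by linarith [htI.1], by rw [hT]; linarith [htI.2]⟩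
    simp only [hua, sub_add_cancel] at h3
    exact h3

end Summit.NavierStokesRegularity.NavierStokesRegularity.Theorems
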